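import Literature.Geometry.Riemannian.MeanConvexHandleShear
import Literature.Geometry.Riemannian.MeanConvexSmoothGramSchmidt
import Literature.Geometry.Riemannian.MeanConvexTube
import Mathlib.Analysis.InnerProductSpace.Adjoint
import Mathlib.LinearAlgebra.Matrix.NonsingularInverse

/-!
# The normalised normal coordinate of a handle core (Fermi data, part 1)

Topic `Geometry/Riemannian` (fact seat
`provefact-Literature.Geometry.Riemannian.LawsonMichelsohn1984_surrounding`).  Everything here
is **proved**; no definitions.

Given a Milnor chart `e` of `ℝⁿ` (a member of the `C^∞` maximal atlas with `B̄(0, R) ⊆ target`)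
and the splitting `ℝⁿ = ℝ^λ × ℝ^k` of its coordinates, the core disc of the handle is
`D = e⁻¹{y⃗ = 0}`.  The tube of Lawson–Michelsohn's Thm. 3.1 around `D` is `{‖Y‖ = r}` for a
`C^∞` map `Y` with `D = {Y = 0}` whose differential is a **co-isometry at the points of `D`**
(so that `‖Y‖` is the distance to `D` to first order): `Y = C(π z) y⃗(e z)`, where `π` is the
chart projection onto `D` and `C` the smooth Gram–Schmidt normaliser of the gradients
`∇(e_{λ+j})` along `D` (`MeanConvexSmoothGramSchmidt`).

* `exists_fermiNormal` — existence of `Y` (values in `K₀ = {x⃗ = 0}`), `C^∞` on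
  `O = e.source ∩ e⁻¹ B(0, R)`, with: zero set `{y⃗ ∘ e = 0}`; radial exactness
  `DY(z)(De⁻¹(0, y⃗)) = Y z`; at the points of `D`: `DY` kills the horizontal chart directions,
  `‖DY† ŷ‖ = ‖ŷ‖`, `DY DY† ŷ = ŷ` for `ŷ ∈ K₀`, `∑ⱼ ‖DY bⱼ‖² = k`; and the comparability
  `‖Y z‖ ≤ C₀ |y⃗|`, `|y⃗| ≤ C₀ ‖Y z‖`, `‖z - π z‖ ≤ C₀ ‖Y z‖` on `e⁻¹ B̄(0, R')`, `R' < R`.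

## References

* H. B. Lawson, Jr., M.-L. Michelsohn, *Embedding and surrounding with positive mean curvature*,
  Invent. Math. 77 (1984), §3 (the tube `T_r(Dᵖ)`). [LawsonMichelsohn1984]
-/

noncomputable section

open Set Function Filter Metric Module Finset
open scoped Topology Manifold ContDiff RealInnerProductSpace Matrix

namespace Literature.Geometry.Riemannian

open Literature.Topology.FourManifolds

variable {n : ℕ}

/-! ### Chart calculus -/

section ChartCalc

variable (e : OpenPartialHomeomorph (EuclideanSpace ℝ (Fin n)) (EuclideanSpace ℝ (Fin n)))

/-- `De(e⁻¹ y) ∘ De⁻¹(y) = id` on the target of a `C¹` chart. [folklore] -/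
theorem fderiv_comp_fderiv_symm_of_mem_target (he : ContDiffOn ℝ ∞ e e.source)
    (he' : ContDiffOn ℝ ∞ e.symm e.target) {y : EuclideanSpace ℝ (Fin n)} (hy : y ∈ e.target)
    (w : EuclideanSpace ℝ (Fin n)) : fderiv ℝ e (e.symm y) (fderiv ℝ e.symm y w) = w := by
  have hsd : DifferentiableAt ℝ e.symm y :=
    (he'.contDiffAt (e.open_target.mem_nhds hy)).differentiableAt (by simp)
  have hed : DifferentiableAt ℝ e (e.symm y) :=
    (he.contDiffAt (e.open_source.mem_nhds (e.map_target hy))).differentiableAt (by simp)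
  have hcomp : HasFDerivAt (e ∘ e.symm) ((fderiv ℝ e (e.symm y)).comp (fderiv ℝ e.symm y)) y :=
    hed.hasFDerivAt.comp y hsd.hasFDerivAt
  have hid : HasFDerivAt (e ∘ e.symm) (ContinuousLinearMap.id ℝ _) y := by
    refine (hasFDerivAt_id y).congr_of_eventuallyEq ?_
    filter_upwards [e.open_target.mem_nhds hy] with u hu
    exact e.right_inv hu
  have := hcomp.unique hid
  have h := congrArg (fun L : EuclideanSpace ℝ (Fin n) →L[ℝ] EuclideanSpace ℝ (Fin n) => L w) this
  simpa using h

/-- `De⁻¹(e z) ∘ De(z) = id` on the source. [folklore] -/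
theorem fderiv_symm_comp_fderiv_of_mem_source (he : ContDiffOn ℝ ∞ e e.source)
    (he' : ContDiffOn ℝ ∞ e.symm e.target) {z : EuclideanSpace ℝ (Fin n)} (hz : z ∈ e.source)
    (w : EuclideanSpace ℝ (Fin n)) : fderiv ℝ e.symm (e z) (fderiv ℝ e z w) = w := by
  have hyt : e z ∈ e.target := e.map_source hz
  have hsd : DifferentiableAt ℝ e.symm (e z) :=
    (he'.contDiffAt (e.open_target.mem_nhds hyt)).differentiableAt (by simp)
  have hed : DifferentiableAt ℝ e z :=
    (he.contDiffAt (e.open_source.mem_nhds hz)).differentiableAt (by simp)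
  have hcomp : HasFDerivAt (e.symm ∘ e) ((fderiv ℝ e.symm (e z)).comp (fderiv ℝ e z)) z :=
    hsd.hasFDerivAt.comp z hed.hasFDerivAt
  have hid : HasFDerivAt (e.symm ∘ e) (ContinuousLinearMap.id ℝ _) z := by
    refine (hasFDerivAt_id z).congr_of_eventuallyEq ?_
    filter_upwards [e.open_source.mem_nhds hz] with u hu
    exact e.left_inv hu
  have := hcomp.unique hid
  have h := congrArg (fun L : EuclideanSpace ℝ (Fin n) →L[ℝ] EuclideanSpace ℝ (Fin n) => L w) this
  simpa using h

/-- The derivative of a chart coordinate: `d(e_i)(z) w = (De(z) w)_i`. [folklore] -/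
theorem fderiv_coord_comp_apply (he : ContDiffOn ℝ ∞ e e.source) {z : EuclideanSpace ℝ (Fin n)}
    (hz : z ∈ e.source) (i : Fin n) (w : EuclideanSpace ℝ (Fin n)) :
    fderiv ℝ (fun z => e z i) z w = fderiv ℝ e z w i := by
  have hed : DifferentiableAt ℝ e z :=
    (he.contDiffAt (e.open_source.mem_nhds hz)).differentiableAt (by simp)
  have h : HasFDerivAt (fun z => e z i) ((EuclideanSpace.proj (𝕜 := ℝ) i).comp (fderiv ℝ e z)) z :=
    (EuclideanSpace.proj (𝕜 := ℝ) i).hasFDerivAt.comp z hed.hasFDerivAt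
  rw [h.fderiv]
  rfl

end ChartCalc

/-! ### Reindexing the expanding coordinates -/

section Reindex

/-- `∑_{λ ≤ i} g i = ∑_{l < k} g (λ + l)` for `λ + k = n`. [folklore] -/
theorem sum_filter_ge_eq_sum_fin {lam k : ℕ} (hk : lam + k = n) (g : Fin n → ℝ) :
    ∑ i ∈ Finset.univ.filter (fun i : Fin n => lam ≤ (i : ℕ)), g i =
      ∑ l : Fin k, g ⟨lam + l, by omega⟩ := by
  refine Finset.sum_bij' (fun i hi => (⟨(i : ℕ) - lam, by rw [Finset.mem_filter] at hi; omega⟩ : Fin k))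
    (fun l _ => (⟨lam + l, by omega⟩ : Fin n)) (fun i hi => Finset.mem_univ _)
    (fun l _ => by simp) (fun i hi => ?_) (fun l _ => ?_) (fun i hi => ?_)
  · rw [Finset.mem_filter] at hi
    ext; simp only; omega
  · ext; simp
  · rw [Finset.mem_filter] at hi
    congr 1; ext; simp only; omega

/-- The squared norm of a vector of `K₀ = {x⃗ = 0}` is the sum over the expanding coordinates.
[folklore] -/
theorem norm_sq_eq_sum_fin_of_lt_eq_zero {lam k : ℕ} (hk : lam + k = n) {y : EuclideanSpace ℝ (Fin n)}
    (hy : ∀ i : Fin n, (i : ℕ) < lam → y i = 0) :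
    ‖y‖ ^ 2 = ∑ l : Fin k, y ⟨lam + l, by omega⟩ ^ 2 := by
  rw [EuclideanSpace.real_norm_sq_eq, ← sum_filter_ge_eq_sum_fin hk (fun i => y i ^ 2)]
  rw [← Finset.sum_filter_add_sum_filter_not Finset.univ (fun i : Fin n => lam ≤ (i : ℕ))]
  have : ∑ i ∈ Finset.univ.filter (fun i : Fin n => ¬lam ≤ (i : ℕ)), y i ^ 2 = 0 :=
    Finset.sum_eq_zero fun i hi => by
      rw [Finset.mem_filter] at hi
      rw [hy i (by omega)]; ring
  rw [this, add_zero]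

end Reindex

/-! ### The normalised normal coordinate -/

section Normal

set_option maxHeartbeats 3200000 in
/-- **The normalised normal coordinate of a handle core.**  See the module docstring.
[cite: LawsonMichelsohn1984, §3] -/
theorem exists_fermiNormal {lam k : ℕ} (hk : lam + k = n)
    (e : OpenPartialHomeomorph (EuclideanSpace ℝ (Fin n)) (EuclideanSpace ℝ (Fin n)))
    (he : e ∈ IsManifold.maximalAtlas (𝓡 n) ∞ (EuclideanSpace ℝ (Fin n))) {R R' : ℝ} (hR' : 0 < R')
    (hRR' : R' < R) (hball : closedBall (0 : EuclideanSpace ℝ (Fin n)) R ⊆ e.target) :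
    ∃ (Y : EuclideanSpace ℝ (Fin n) → EuclideanSpace ℝ (Fin n)) (C₀ : ℝ),
      ContDiffOn ℝ ∞ Y (e.source ∩ e ⁻¹' ball 0 R) ∧ 0 < C₀ ∧
      -- values in `K₀`
      (∀ z ∈ e.source ∩ e ⁻¹' ball 0 R, ∀ i : Fin n, (i : ℕ) < lam → Y z i = 0) ∧
      -- zero set
      (∀ z ∈ e.source ∩ e ⁻¹' ball 0 R, Y z = 0 ↔ ∀ i : Fin n, lam ≤ (i : ℕ) → e z i = 0) ∧
      -- radial exactness
      (∀ z ∈ e.source ∩ e ⁻¹' ball 0 R,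
        fderiv ℝ Y z (fderiv ℝ e.symm (e z) ((1 / 2 : ℝ) • (e z + milnorModelField lam (e z)))) = Y z) ∧
      -- flatness on the disc
      (∀ d ∈ e.source ∩ e ⁻¹' ball 0 R, (∀ i : Fin n, lam ≤ (i : ℕ) → e d i = 0) →
        (∀ w : EuclideanSpace ℝ (Fin n), (∀ i : Fin n, lam ≤ (i : ℕ) → w i = 0) →
          fderiv ℝ Y d (fderiv ℝ e.symm (e d) w) = 0) ∧
        (∀ v : EuclideanSpace ℝ (Fin n), (∀ i : Fin n, (i : ℕ) < lam → v i = 0) →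
          ‖(fderiv ℝ Y d).adjoint v‖ = ‖v‖ ∧ fderiv ℝ Y d ((fderiv ℝ Y d).adjoint v) = v) ∧
        ∑ j, ‖fderiv ℝ Y d (EuclideanSpace.basisFun (Fin n) ℝ j)‖ ^ 2 = k) ∧
      -- comparability on `e⁻¹ B̄(0, R')`
      (∀ z ∈ e.source, e z ∈ closedBall (0 : EuclideanSpace ℝ (Fin n)) R' →
        ‖Y z‖ ≤ C₀ * Real.sqrt (sqSumGE lam (e z)) ∧ Real.sqrt (sqSumGE lam (e z)) ≤ C₀ * ‖Y z‖ ∧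
        ‖z - e.symm ((1 / 2 : ℝ) • (e z - milnorModelField lam (e z)))‖ ≤ C₀ * ‖Y z‖) := by
  classical
  -- ### smoothness of the chart
  have hsymm : ContDiffOn ℝ ∞ e.symm e.target :=
    contMDiffOn_iff_contDiffOn.1 (contMDiffOn_symm_of_mem_maximalAtlas he)
  have hfwd : ContDiffOn ℝ ∞ e e.source := contMDiffOn_iff_contDiffOn.1 (contMDiffOn_of_mem_maximalAtlas he)
  have hR : 0 < R := hR'.trans hRR'
  set O : Set (EuclideanSpace ℝ (Fin n)) := e.source ∩ e ⁻¹' ball 0 R with hO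
  have hOopen : IsOpen O := e.isOpen_inter_preimage isOpen_ball
  have hOsrc : O ⊆ e.source := inter_subset_left
  have hOt : ∀ z ∈ O, e z ∈ e.target := fun z hz => e.map_source hz.1
  have hcoord : ∀ i : Fin n, ContDiff ℝ ∞ fun y : EuclideanSpace ℝ (Fin n) => y i := fun i =>
    (EuclideanSpace.proj (𝕜 := ℝ) i).contDiff
  -- index map
  set idx : Fin k → Fin n := fun l => ⟨lam + l, by omega⟩ with hidx
  have hidx_ge : ∀ l : Fin k, lam ≤ (idx l : ℕ) := fun l => by simp [hidx]
  have hidx_inj : Function.Injective idx := fun l l' h => by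
    simp only [hidx, Fin.mk.injEq] at h; exact Fin.ext (by omega)
  -- ### the gradients of the expanding coordinates
  set b := EuclideanSpace.basisFun (Fin n) ℝ with hb
  set v : ℕ → EuclideanSpace ℝ (Fin n) → EuclideanSpace ℝ (Fin n) := fun j d =>
    if hj : j < k then ∑ i, fderiv ℝ (fun z => e z (idx ⟨j, hj⟩)) d (b i) • b i else 0 with hv
  have hv_inner : ∀ j (hj : j < k), ∀ d ∈ e.source, ∀ w,
      ⟪v j d, w⟫ = fderiv ℝ e d w (idx ⟨j, hj⟩) := by
    intro j hj d hd w
    rw [hv]; dsimp only; rw [dif_pos hj, sum_fderiv_apply_smul_eq_toDual_symm,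
      InnerProductSpace.toDual_symm_apply, fderiv_coord_comp_apply e hfwd hd]
  have hv_smooth : ∀ j < k, ContDiffOn ℝ ∞ (v j) e.source := by
    intro j hj
    have : v j = fun d => ∑ i, fderiv ℝ (fun z => e z (idx ⟨j, hj⟩)) d (b i) • b i := by
      funext d; rw [hv]; dsimp only; rw [dif_pos hj]
    rw [this]
    refine ContDiffOn.sum fun i _ => ?_
    have h1 : ContDiffOn ℝ ∞ (fun z => e z (idx ⟨j, hj⟩)) e.source :=
      (hcoord _).comp_contDiffOn hfwd
    have h2 : ContDiffOn ℝ ∞ (fun z => fderiv ℝ (fun z => e z (idx ⟨j, hj⟩)) z (b i)) e.source :=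
      (h1.fderiv_of_isOpen e.open_source (by simp)).clm_apply contDiffOn_const
    exact h2.smul contDiffOn_const
  have hv_indep : ∀ d ∈ e.source, LinearIndependent ℝ (fun j : Fin k => v j d) := by
    intro d hd
    rw [Fintype.linearIndependent_iff]
    intro a ha j₀
    -- pair with `De⁻¹(e d) (b (idx j₀))`
    have h := congrArg (fun x => ⟪x, fderiv ℝ e.symm (e d) (b (idx j₀))⟫) ha
    simp only [sum_inner, real_inner_smul_left, inner_zero_left] at h
    have hterm : ∀ j : Fin k, ⟪v j d, fderiv ℝ e.symm (e d) (b (idx j₀))⟫ = if j = j₀ then 1 else 0 := by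
      intro j
      have hcan := fderiv_comp_fderiv_symm_of_mem_target e hfwd hsymm (e.map_source hd) (b (idx j₀))
      rw [e.left_inv hd] at hcan
      rw [hv_inner j j.isLt d hd, hcan, hb, EuclideanSpace.basisFun_apply, PiLp.single_apply]
      simp only [Fin.eta]
      by_cases hjj : j = j₀
      · subst hjj; simp
      · rw [if_neg (fun h' => hjj (hidx_inj h'.symm).symm), if_neg hjj]
    simp only [hterm, mul_ite, mul_one, mul_zero, Finset.sum_ite_eq', Finset.mem_univ, if_true] at h
    exact h
  -- ### Gram–Schmidt
  obtain ⟨c, hc_smooth, hc_tri, hc_diag, hc_orth⟩ :=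
    exists_smooth_gramSchmidt_coeff (U := e.source) k v hv_smooth hv_indep
  -- the orthonormal rows
  set u : ℕ → EuclideanSpace ℝ (Fin n) → EuclideanSpace ℝ (Fin n) := fun l d =>
    ∑ j ∈ range k, c l j d • v j d with hu
  have hu_orth : ∀ d ∈ e.source, Orthonormal ℝ (fun l : Fin k => u l d) := fun d hd => hc_orth d hd
  -- ### the projection onto the disc and the map `Y`
  set P₀ : EuclideanSpace ℝ (Fin n) → EuclideanSpace ℝ (Fin n) := fun y =>
    (1 / 2 : ℝ) • (y - milnorModelField lam y) with hP₀
  have hP₀_apply : ∀ y i, P₀ y i = if (i : ℕ) < lam then y i else 0 := by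
    intro y i
    have hP₀y : P₀ y = (1 / 2 : ℝ) • (y - milnorModelField lam y) := rfl
    rw [hP₀y, PiLp.smul_apply, sub_milnorModelField_apply, smul_eq_mul]
    split_ifs <;> ring
  have hP₀_norm : ∀ y, ‖P₀ y‖ ≤ ‖y‖ := by
    intro y
    have h1 : ‖P₀ y‖ ^ 2 ≤ ‖y‖ ^ 2 := by
      rw [EuclideanSpace.real_norm_sq_eq, EuclideanSpace.real_norm_sq_eq]
      refine Finset.sum_le_sum fun i _ => ?_
      rw [hP₀_apply]; split_ifs
      · exact le_rfl
      · simp only [ne_eq, OfNat.ofNat_ne_zero, not_false_eq_true, zero_pow]; positivity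
    exact (pow_le_pow_iff_left₀ (norm_nonneg _) (norm_nonneg _) two_ne_zero).1 h1
  have hP₀c : ContDiff ℝ ∞ P₀ := by
    refine contDiff_euclidean.2 fun i => ?_
    have : (fun y => P₀ y i) = fun y : EuclideanSpace ℝ (Fin n) => if (i : ℕ) < lam then y i else 0 := by
      funext y; exact hP₀_apply y i
    rw [this]
    split_ifs
    · exact hcoord i
    · exact contDiff_const
  set π : EuclideanSpace ℝ (Fin n) → EuclideanSpace ℝ (Fin n) := fun z => e.symm (P₀ (e z)) with hπ
  have hπ_def : ∀ z, π z = e.symm (P₀ (e z)) := fun z => rfl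
  have hP₀ball : ∀ z ∈ O, P₀ (e z) ∈ ball (0 : EuclideanSpace ℝ (Fin n)) R := fun z hz => by
    have : e z ∈ ball (0 : EuclideanSpace ℝ (Fin n)) R := hz.2
    rw [mem_ball_zero_iff] at this ⊢
    exact (hP₀_norm _).trans_lt this
  have hP₀t : ∀ z ∈ O, P₀ (e z) ∈ e.target := fun z hz =>
    hball (ball_subset_closedBall (hP₀ball z hz))
  have heπ : ∀ z ∈ O, e (π z) = P₀ (e z) := fun z hz => by
    rw [hπ_def]; exact e.right_inv (hP₀t z hz)
  have hπO : ∀ z ∈ O, π z ∈ O := fun z hz => by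
    refine ⟨?_, ?_⟩
    · rw [hπ_def]; exact e.map_target (hP₀t z hz)
    · rw [Set.mem_preimage, heπ z hz]; exact hP₀ball z hz
  have hπsrc : ∀ z ∈ O, π z ∈ e.source := fun z hz => (hπO z hz).1
  have hπc : ContDiffOn ℝ ∞ π O := by
    have h1 : ContDiffOn ℝ ∞ (fun z => P₀ (e z)) O := (hP₀c.comp_contDiffOn hfwd).mono hOsrc
    have h2 : ContDiffOn ℝ ∞ (e.symm ∘ fun z => P₀ (e z)) O := hsymm.comp h1 fun z hz => hP₀t z hz
    exact h2
  have hπ_disc : ∀ d ∈ O, (∀ i : Fin n, lam ≤ (i : ℕ) → e d i = 0) → π d = d := by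
    intro d hd hd0
    have : P₀ (e d) = e d := by
      ext i; rw [hP₀_apply]; split_ifs with h
      · rfl
      · exact (hd0 i (not_lt.1 h)).symm
    rw [hπ_def, this, e.left_inv hd.1]
  -- `Y z = ∑_l (∑_j c l j (π z) * (e z)_(λ+j)) • b_(λ+l)`
  set Yc : EuclideanSpace ℝ (Fin n) → Fin k → ℝ := fun z l =>
    ∑ j : Fin k, c l j (π z) * e z (idx j) with hYc
  set Y : EuclideanSpace ℝ (Fin n) → EuclideanSpace ℝ (Fin n) := fun z =>
    ∑ l : Fin k, Yc z l • b (idx l) with hY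
  have hY_def : ∀ z, Y z = ∑ l : Fin k, Yc z l • b (idx l) := fun z => rfl
  have hYc_def : ∀ z l, Yc z l = ∑ j : Fin k, c l j (π z) * e z (idx j) := fun z l => rfl
  -- coordinates of such sums
  have hsum_apply : ∀ (a : Fin k → ℝ) (i : Fin n),
      (∑ l : Fin k, a l • b (idx l)) i = if h : lam ≤ (i : ℕ) then a ⟨(i : ℕ) - lam, by omega⟩ else 0 := by
    intro a i
    rw [show (∑ l : Fin k, a l • b (idx l)) i = ∑ l : Fin k, (a l • b (idx l)) i from by
      simp [Finset.sum_apply, WithLp.ofLp_sum]]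
    simp only [PiLp.smul_apply, hb, EuclideanSpace.basisFun_apply, PiLp.single_apply,
      smul_eq_mul, mul_ite, mul_one, mul_zero]
    by_cases h : lam ≤ (i : ℕ)
    · rw [dif_pos h]
      rw [Finset.sum_eq_single (⟨(i : ℕ) - lam, by omega⟩ : Fin k)]
      · rw [if_pos]; ext; simp [hidx]; omega
      · intro l _ hl
        rw [if_neg]
        intro h'
        apply hl
        ext; have := congrArg Fin.val h'; simp [hidx] at this; simp; omega
      · intro h'; exact absurd (Finset.mem_univ _) h'
    · rw [dif_neg h]
      refine Finset.sum_eq_zero fun l _ => ?_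
      rw [if_neg]
      intro h'
      apply h
      have := congrArg Fin.val h'; simp [hidx] at this; omega
  have hY_apply_lt : ∀ z (i : Fin n), (i : ℕ) < lam → Y z i = 0 := by
    intro z i hi
    rw [hY_def, hsum_apply, dif_neg (by omega)]
  have hY_apply_idx : ∀ z (l : Fin k), Y z (idx l) = Yc z l := by
    intro z l
    rw [hY_def, hsum_apply, dif_pos (hidx_ge l)]
    congr 1; ext; simp [hidx]
  have hY_norm_sq : ∀ z, ‖Y z‖ ^ 2 = ∑ l : Fin k, Yc z l ^ 2 := by
    intro z
    rw [norm_sq_eq_sum_fin_of_lt_eq_zero hk (hY_apply_lt z)]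
    exact Finset.sum_congr rfl fun l _ => by rw [show (⟨lam + l, _⟩ : Fin n) = idx l from rfl, hY_apply_idx]
  -- ### smoothness of `Y`
  have hYc_smooth : ∀ l : Fin k, ContDiffOn ℝ ∞ (fun z => Yc z l) O := by
    intro l
    refine ContDiffOn.sum fun j _ => ContDiffOn.mul ?_ ?_
    · exact (hc_smooth l j).comp hπc fun z hz => hπsrc z hz
    · exact ((hcoord _).comp_contDiffOn hfwd).mono hOsrc
  have hY_smooth : ContDiffOn ℝ ∞ Y O :=
    ContDiffOn.sum fun l _ => (hYc_smooth l).smul contDiffOn_const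
  -- the norm of a `K₀`-combination
  have hnorm_comb : ∀ a : Fin k → ℝ, ‖∑ l : Fin k, a l • b (idx l)‖ ^ 2 = ∑ l : Fin k, a l ^ 2 := by
    intro a
    have hlt : ∀ i : Fin n, (i : ℕ) < lam → (∑ l : Fin k, a l • b (idx l)) i = 0 := fun i hi => by
      rw [hsum_apply, dif_neg (by omega)]
    rw [norm_sq_eq_sum_fin_of_lt_eq_zero hk hlt]
    refine Finset.sum_congr rfl fun l _ => ?_
    rw [show (⟨lam + l, by omega⟩ : Fin n) = idx l from rfl, hsum_apply, dif_pos (hidx_ge l)]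
    congr 2; ext; simp [hidx]
  -- ### the inverse of the Gram–Schmidt matrix: `y_(λ+j) = ∑_l ⟨v_j, u_l⟩ Yc_l`
  have hu_fin : ∀ l d, u l d = ∑ j : Fin k, c l j d • v j d := fun l d => by
    rw [hu]; exact (Fin.sum_univ_eq_sum_range (fun j => c l j d • v j d) k).symm
  have hinv : ∀ d ∈ e.source, ∀ j j' : Fin k,
      ∑ l : Fin k, ⟪v j d, u l d⟫ * c l j' d = if j = j' then 1 else 0 := by
    intro d hd j j'
    set Cm : Matrix (Fin k) (Fin k) ℝ := Matrix.of fun l j => c l j d with hCm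
    set Dm : Matrix (Fin k) (Fin k) ℝ := Matrix.of fun j l => ⟪v j d, u l d⟫ with hDm
    have hCD : Cm * Dm = 1 := by
      ext l l'
      rw [Matrix.mul_apply, Matrix.one_apply]
      have h1 : ∑ j, Cm l j * Dm j l' = ⟪u l d, u l' d⟫ := by
        rw [hu_fin l d, sum_inner]
        refine Finset.sum_congr rfl fun j _ => ?_
        rw [real_inner_smul_left]; rfl
      rw [h1]
      have := orthonormal_iff_ite.1 (hu_orth d hd) l l'
      rw [this]
    have hDC : Dm * Cm = 1 := mul_eq_one_comm.1 hCD
    have h := congrFun (congrFun hDC j) j'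
    rw [Matrix.mul_apply, Matrix.one_apply] at h
    exact h
  have hcoord_inv : ∀ z ∈ O, ∀ j : Fin k,
      e z (idx j) = ∑ l : Fin k, ⟪v j (π z), u l (π z)⟫ * Yc z l := by
    intro z hz j
    have hd := hπsrc z hz
    calc e z (idx j) = ∑ j' : Fin k, (if j = j' then 1 else 0) * e z (idx j') := by
          rw [Finset.sum_eq_single j (fun j' _ hj' => by rw [if_neg (Ne.symm hj'), zero_mul])
            (fun h => absurd (Finset.mem_univ _) h), if_pos rfl, one_mul]
      _ = ∑ j' : Fin k, (∑ l : Fin k, ⟪v j (π z), u l (π z)⟫ * c l j' (π z)) * e z (idx j') :=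
          Finset.sum_congr rfl fun j' _ => by rw [hinv _ hd]
      _ = ∑ l : Fin k, ⟪v j (π z), u l (π z)⟫ * Yc z l := by
          simp only [hYc_def, Finset.mul_sum, Finset.sum_mul]
          rw [Finset.sum_comm]
          exact Finset.sum_congr rfl fun l _ => Finset.sum_congr rfl fun j' _ => by ring
  -- ### derivatives of `Y`
  -- `P₀` as a continuous linear map
  set mvL : EuclideanSpace ℝ (Fin n) →L[ℝ] EuclideanSpace ℝ (Fin n) :=
    LinearMap.toContinuousLinearMap
      { toFun := fun y => milnorModelField lam y
        map_add' := fun y y' => by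
          ext i; simp only [milnorModelField_apply, PiLp.add_apply]; split_ifs <;> ring
        map_smul' := fun a y => by
          ext i; simp only [milnorModelField_apply, PiLp.smul_apply, smul_eq_mul, RingHom.id_apply]
          split_ifs <;> ring } with hmvL
  have hmvL_apply : ∀ y, mvL y = milnorModelField lam y := fun y => rfl
  set P₀L : EuclideanSpace ℝ (Fin n) →L[ℝ] EuclideanSpace ℝ (Fin n) :=
    (1 / 2 : ℝ) • (ContinuousLinearMap.id ℝ _ - mvL) with hP₀L
  have hP₀L_apply : ∀ y, P₀L y = P₀ y := fun y => rfl
  have hP₀_deriv : ∀ y, HasFDerivAt P₀ P₀L y := fun y => by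
    have : (P₀ : EuclideanSpace ℝ (Fin n) → EuclideanSpace ℝ (Fin n)) = P₀L := funext fun y => (hP₀L_apply y).symm
    rw [this]; exact P₀L.hasFDerivAt
  -- differentiability facts on `O`
  have hed : ∀ z ∈ e.source, HasFDerivAt e (fderiv ℝ e z) z := fun z hz =>
    ((hfwd.contDiffAt (e.open_source.mem_nhds hz)).differentiableAt (by simp)).hasFDerivAt
  have hsd : ∀ y ∈ e.target, HasFDerivAt e.symm (fderiv ℝ e.symm y) y := fun y hy =>
    ((hsymm.contDiffAt (e.open_target.mem_nhds hy)).differentiableAt (by simp)).hasFDerivAt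
  have hπ_deriv : ∀ z ∈ O, HasFDerivAt π
      ((fderiv ℝ e.symm (P₀ (e z))).comp (P₀L.comp (fderiv ℝ e z))) z := fun z hz =>
    (hsd _ (hP₀t z hz)).comp z ((hP₀_deriv _).comp z (hed z hz.1))
  have hcπ_deriv : ∀ z ∈ O, ∀ l j, HasFDerivAt (fun z => c l j (π z))
      ((fderiv ℝ (c l j) (π z)).comp ((fderiv ℝ e.symm (P₀ (e z))).comp (P₀L.comp (fderiv ℝ e z)))) z := by
    intro z hz l j
    have hcd : DifferentiableAt ℝ (c l j) (π z) :=
      ((hc_smooth l j).contDiffAt (e.open_source.mem_nhds (hπsrc z hz))).differentiableAt (by simp)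
    exact hcd.hasFDerivAt.comp z (hπ_deriv z hz)
  have hcoord_deriv : ∀ z ∈ e.source, ∀ i : Fin n, HasFDerivAt (fun z => e z i)
      ((EuclideanSpace.proj (𝕜 := ℝ) i).comp (fderiv ℝ e z)) z := fun z hz i =>
    (EuclideanSpace.proj (𝕜 := ℝ) i).hasFDerivAt.comp z (hed z hz)
  -- the derivative of `Yc · l` and of `Y`
  have hYc_deriv : ∀ z ∈ O, ∀ l : Fin k, HasFDerivAt (fun z => Yc z l)
      (∑ j : Fin k, (c l j (π z) • (EuclideanSpace.proj (𝕜 := ℝ) (idx j)).comp (fderiv ℝ e z) +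
        e z (idx j) • (fderiv ℝ (c l j) (π z)).comp
          ((fderiv ℝ e.symm (P₀ (e z))).comp (P₀L.comp (fderiv ℝ e z))))) z := by
    intro z hz l
    have : (fun z => Yc z l) = fun z => ∑ j : Fin k, c l j (π z) * e z (idx j) := rfl
    rw [this]
    refine HasFDerivAt.fun_sum fun j _ => ?_
    have h := (hcπ_deriv z hz l j).mul (hcoord_deriv z hz.1 (idx j))
    exact h
  have hY_deriv : ∀ z ∈ O, ∀ w, fderiv ℝ Y z w =
      ∑ l : Fin k, (∑ j : Fin k, (c l j (π z) * (fderiv ℝ e z w) (idx j) +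
        e z (idx j) * fderiv ℝ (c l j) (π z)
          (fderiv ℝ e.symm (P₀ (e z)) (P₀L (fderiv ℝ e z w))))) • b (idx l) := by
    intro z hz w
    have h : HasFDerivAt Y (∑ l : Fin k, (∑ j : Fin k,
        (c l j (π z) • (EuclideanSpace.proj (𝕜 := ℝ) (idx j)).comp (fderiv ℝ e z) +
          e z (idx j) • (fderiv ℝ (c l j) (π z)).comp
            ((fderiv ℝ e.symm (P₀ (e z))).comp (P₀L.comp (fderiv ℝ e z))))).smulRight (b (idx l))) z := by
      have : Y = fun z => ∑ l : Fin k, Yc z l • b (idx l) := rfl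
      rw [this]
      exact HasFDerivAt.fun_sum fun l _ => (hYc_deriv z hz l).smul_const (b (idx l))
    rw [h.fderiv]
    simp only [FunLike.coe_sum, Finset.sum_apply, ContinuousLinearMap.smulRight_apply,
      _root_.add_apply, FunLike.coe_smul, Pi.smul_apply,
      ContinuousLinearMap.comp_apply, smul_eq_mul]
    rfl
  -- ### the derivative at the points of the disc
  have hY_deriv_disc : ∀ d ∈ O, (∀ i : Fin n, lam ≤ (i : ℕ) → e d i = 0) → ∀ w,
      fderiv ℝ Y d w = ∑ l : Fin k, ⟪u l d, w⟫ • b (idx l) := by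
    intro d hd hd0 w
    rw [hY_deriv d hd w]
    refine Finset.sum_congr rfl fun l _ => ?_
    congr 1
    rw [hu_fin l d, sum_inner]
    refine Finset.sum_congr rfl fun j _ => ?_
    rw [hd0 _ (hidx_ge j), zero_mul, add_zero, hπ_disc d hd hd0, real_inner_smul_left,
      hv_inner j j.isLt d hd.1]
  -- ### comparability constants
  set KD : Set (EuclideanSpace ℝ (Fin n)) := e.symm '' closedBall 0 R' with hKD
  have hKDt : closedBall (0 : EuclideanSpace ℝ (Fin n)) R' ⊆ e.target :=
    (closedBall_subset_closedBall hRR'.le).trans hball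
  have hKDc : IsCompact KD :=
    (isCompact_closedBall 0 R').image_of_continuousOn (hsymm.continuousOn.mono hKDt)
  have hKDsrc : KD ⊆ e.source := by
    rintro _ ⟨y, hy, rfl⟩; exact e.map_target (hKDt hy)
  have hmemKD : ∀ z ∈ e.source, e z ∈ closedBall (0 : EuclideanSpace ℝ (Fin n)) R' → z ∈ KD ∧ z ∈ O ∧ π z ∈ KD := by
    intro z hz hzR
    refine ⟨⟨e z, hzR, e.left_inv hz⟩, ⟨hz, ?_⟩, ⟨P₀ (e z), ?_, rfl⟩⟩
    · show e z ∈ ball (0 : EuclideanSpace ℝ (Fin n)) R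
      exact mem_ball_zero_iff.2 ((mem_closedBall_zero_iff.1 hzR).trans_lt hRR')
    · rw [mem_closedBall_zero_iff] at hzR ⊢
      exact (hP₀_norm _).trans hzR
  obtain ⟨Mv, hMv⟩ : ∃ M, ∀ j < k, ∀ d ∈ KD, ‖v j d‖ ≤ M := by
    have : ∀ j < k, ∃ M, ∀ d ∈ KD, ‖v j d‖ ≤ M := fun j hj =>
      hKDc.exists_bound_of_continuousOn ((hv_smooth j hj).continuousOn.mono hKDsrc)
    choose! M hM using this
    refine ⟨∑ j ∈ range k, |M j|, fun j hj d hd => (hM j hj d hd).trans ?_⟩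
    exact (le_abs_self _).trans (Finset.single_le_sum (fun i _ => abs_nonneg (M i)) (mem_range.2 hj))
  obtain ⟨Mc, hMc⟩ : ∃ M, ∀ l < k, ∀ j < k, ∀ d ∈ KD, |c l j d| ≤ M := by
    have : ∀ l < k, ∀ j < k, ∃ M, ∀ d ∈ KD, |c l j d| ≤ M := fun l hl j hj => by
      obtain ⟨M, hM⟩ := hKDc.exists_bound_of_continuousOn ((hc_smooth l j).continuousOn.mono hKDsrc)
      exact ⟨M, fun d hd => by have := hM d hd; rwa [Real.norm_eq_abs] at this⟩
    choose! M hM using this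
    refine ⟨∑ l ∈ range k, ∑ j ∈ range k, |M l j|, fun l hl j hj d hd => (hM l hl j hj d hd).trans ?_⟩
    refine (le_abs_self _).trans ((Finset.single_le_sum (fun j _ => abs_nonneg (M l j)) (mem_range.2 hj)).trans ?_)
    exact Finset.single_le_sum (fun l _ => Finset.sum_nonneg fun j _ => abs_nonneg (M l j)) (mem_range.2 hl)
  obtain ⟨Lψ, hLψ⟩ := (hsymm.mono hKDt).exists_lipschitzOnWith (by simp) (convex_closedBall 0 R')
    (isCompact_closedBall 0 R')
  have hMv' : ∀ j < k, ∀ d ∈ KD, ‖v j d‖ ≤ |Mv| := fun j hj d hd => (hMv j hj d hd).trans (le_abs_self _)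
  have hMc' : ∀ l < k, ∀ j < k, ∀ d ∈ KD, |c l j d| ≤ |Mc| := fun l hl j hj d hd =>
    (hMc l hl j hj d hd).trans (le_abs_self _)
  -- ### small facts
  have hQ₀_apply : ∀ (y : EuclideanSpace ℝ (Fin n)) (i : Fin n),
      ((1 / 2 : ℝ) • (y + milnorModelField lam y)) i = if (i : ℕ) < lam then 0 else y i := by
    intro y i
    rw [PiLp.smul_apply, PiLp.add_apply, milnorModelField_apply, smul_eq_mul]
    split_ifs <;> ring
  have hP₀Q₀ : ∀ y : EuclideanSpace ℝ (Fin n), P₀ ((1 / 2 : ℝ) • (y + milnorModelField lam y)) = 0 := by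
    intro y; ext i
    rw [hP₀_apply, hQ₀_apply]
    split_ifs <;> rfl
  have hS : ∀ z, sqSumGE lam (e z) = ∑ j : Fin k, e z (idx j) ^ 2 := fun z =>
    sum_filter_ge_eq_sum_fin hk (fun i => (e z i) ^ 2)
  have hYc_le : ∀ z l, |Yc z l| ≤ ‖Y z‖ := by
    intro z l
    refine (pow_le_pow_iff_left₀ (abs_nonneg _) (norm_nonneg _) two_ne_zero).1 ?_
    rw [sq_abs, hY_norm_sq]
    exact Finset.single_le_sum (fun l _ => sq_nonneg (Yc z l)) (Finset.mem_univ l)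
  have hcoord_le : ∀ z (j : Fin k), |e z (idx j)| ≤ Real.sqrt (sqSumGE lam (e z)) := by
    intro z j
    rw [← Real.sqrt_sq_eq_abs]
    refine Real.sqrt_le_sqrt ?_
    rw [hS]
    exact Finset.single_le_sum (fun j _ => sq_nonneg (e z (idx j))) (Finset.mem_univ j)
  have hS_nonneg : ∀ z, 0 ≤ sqSumGE lam (e z) := fun z => sqSumGE_nonneg _ _
  have hdiff_norm : ∀ y : EuclideanSpace ℝ (Fin n), ‖y - P₀ y‖ ^ 2 = sqSumGE lam y := by
    intro y
    have hlt : ∀ i : Fin n, (i : ℕ) < lam → (y - P₀ y) i = 0 := fun i hi => by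
      rw [PiLp.sub_apply, hP₀_apply, if_pos hi, sub_self]
    rw [norm_sq_eq_sum_fin_of_lt_eq_zero hk hlt]
    rw [show sqSumGE lam y = ∑ j : Fin k, y (idx j) ^ 2 from sum_filter_ge_eq_sum_fin hk (fun i => (y i) ^ 2)]
    refine Finset.sum_congr rfl fun l _ => ?_
    have hnl : ¬((⟨lam + l, by omega⟩ : Fin n) : ℕ) < lam := by simp
    rw [PiLp.sub_apply, hP₀_apply, if_neg hnl, sub_zero]
  -- ### the constant
  set C₁ : ℝ := (k : ℝ) ^ 2 * |Mc| + 1 with hC₁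
  set C₂ : ℝ := (k : ℝ) ^ 2 * |Mv| + 1 with hC₂
  set C₀ : ℝ := C₁ + C₂ + (Lψ + 1) * C₂ with hC₀
  have hC₁1 : 1 ≤ C₁ := by rw [hC₁]; have : 0 ≤ (k : ℝ) ^ 2 * |Mc| := (by positivity); linarith
  have hC₂1 : 1 ≤ C₂ := by rw [hC₂]; have : 0 ≤ (k : ℝ) ^ 2 * |Mv| := (by positivity); linarith
  have hC₀pos : 0 < C₀ := by rw [hC₀]; have : 0 ≤ (Lψ + 1 : ℝ) * C₂ := (by positivity); linarith
  have hC₀1 : C₁ ≤ C₀ := by rw [hC₀]; have : 0 ≤ (Lψ + 1 : ℝ) * C₂ := (by positivity); linarith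
  have hC₀2 : C₂ ≤ C₀ := by rw [hC₀]; have : 0 ≤ (Lψ + 1 : ℝ) * C₂ := (by positivity); linarith
  have hC₀3 : (Lψ : ℝ) * C₂ ≤ C₀ := by rw [hC₀]; nlinarith [hC₁1, hC₂1]
  -- ### conclusions
  refine ⟨Y, C₀, hY_smooth, hC₀pos, fun z _ i hi => hY_apply_lt z i hi, fun z hz => ⟨fun hY0 i hi => ?_,
    fun h0 => ?_⟩, fun z hz => ?_, fun d hd hd0 => ⟨fun w hw => ?_, fun v' hv' => ?_, ?_⟩, fun z hz hzR => ?_⟩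
  · -- zero set, `→`
    have hj : (i : ℕ) - lam < k := by omega
    have hi' : idx ⟨(i : ℕ) - lam, hj⟩ = i := by ext; simp [hidx]; omega
    rw [← hi', hcoord_inv z hz]
    refine Finset.sum_eq_zero fun l _ => ?_
    rw [← hY_apply_idx z l, hY0]
    simp
  · -- zero set, `←`
    rw [hY_def]
    refine Finset.sum_eq_zero fun l _ => ?_
    have : Yc z l = 0 := by
      rw [hYc_def]; exact Finset.sum_eq_zero fun j _ => by rw [h0 _ (hidx_ge j), mul_zero]
    rw [this, zero_smul]
  · -- radial exactness
    set q : EuclideanSpace ℝ (Fin n) := (1 / 2 : ℝ) • (e z + milnorModelField lam (e z)) with hq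
    have hcan : fderiv ℝ e z (fderiv ℝ e.symm (e z) q) = q := by
      have h := fderiv_comp_fderiv_symm_of_mem_target e hfwd hsymm (hOt z hz) q
      rwa [e.left_inv hz.1] at h
    rw [hY_deriv z hz, hY_def]
    refine Finset.sum_congr rfl fun l _ => ?_
    congr 1
    rw [hYc_def]
    refine Finset.sum_congr rfl fun j _ => ?_
    rw [hcan, hP₀L_apply, hq, hP₀Q₀, map_zero, map_zero, mul_zero, add_zero, hQ₀_apply,
      if_neg (not_lt.2 (hidx_ge j))]
  · -- flatness: horizontal directions are killed
    rw [hY_deriv_disc d hd hd0]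
    refine Finset.sum_eq_zero fun l _ => ?_
    have : ⟪u l d, fderiv ℝ e.symm (e d) w⟫ = 0 := by
      rw [hu_fin l d, sum_inner]
      refine Finset.sum_eq_zero fun j _ => ?_
      have hcan := fderiv_comp_fderiv_symm_of_mem_target e hfwd hsymm (hOt d hd) w
      rw [e.left_inv hd.1] at hcan
      rw [real_inner_smul_left, hv_inner j j.isLt d hd.1, hcan, hw _ (hidx_ge j), mul_zero]
    rw [this, zero_smul]
  · -- flatness: the adjoint
    have hL : ∀ w, fderiv ℝ Y d w = ∑ l : Fin k, ⟪u l d, w⟫ • b (idx l) := hY_deriv_disc d hd hd0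
    set a : Fin k → ℝ := fun l => v' (idx l) with ha
    have hadj : (fderiv ℝ Y d).adjoint v' = ∑ l : Fin k, a l • u l d := by
      refine ext_inner_right ℝ fun w => ?_
      rw [ContinuousLinearMap.adjoint_inner_left, hL w, inner_sum, sum_inner]
      refine Finset.sum_congr rfl fun l _ => ?_
      rw [real_inner_smul_right, real_inner_smul_left, ha, hb, EuclideanSpace.inner_basisFun_real]
      ring
    have horth := hu_orth d hd.1
    have hnorm2 : ‖∑ l : Fin k, a l • u l d‖ ^ 2 = ∑ l : Fin k, a l ^ 2 := by
      rw [← real_inner_self_eq_norm_sq, sum_inner]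
      refine Finset.sum_congr rfl fun l _ => ?_
      rw [real_inner_smul_left, horth.inner_right_fintype a l]; ring
    have hv'norm : ‖v'‖ ^ 2 = ∑ l : Fin k, a l ^ 2 := norm_sq_eq_sum_fin_of_lt_eq_zero hk hv'
    constructor
    · rw [hadj]
      have h1 : ‖∑ l : Fin k, a l • u l d‖ ^ 2 = ‖v'‖ ^ 2 := by rw [hnorm2, hv'norm]
      rw [← Real.sqrt_sq (norm_nonneg (∑ l : Fin k, a l • u l d)), h1, Real.sqrt_sq (norm_nonneg _)]
    · rw [hadj, hL]
      have hinner : ∀ l : Fin k, ⟪u l d, ∑ l' : Fin k, a l' • u l' d⟫ = a l := fun l =>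
        horth.inner_right_fintype a l
      simp only [hinner]
      ext i
      rw [hsum_apply]
      by_cases hi : lam ≤ (i : ℕ)
      · rw [dif_pos hi, ha]
        have hii : idx ⟨(i : ℕ) - lam, by omega⟩ = i := Fin.ext (by simp [hidx]; omega)
        show v' (idx ⟨(i : ℕ) - lam, _⟩) = v' i
        rw [hii]
      · rw [dif_neg hi, hv' i (by omega)]
  · -- flatness: the Hilbert–Schmidt norm
    have hL : ∀ w, fderiv ℝ Y d w = ∑ l : Fin k, ⟪u l d, w⟫ • b (idx l) := hY_deriv_disc d hd hd0
    simp only [hL, hnorm_comb]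
    rw [Finset.sum_comm]
    have horth := hu_orth d hd.1
    have h1 : ∀ l : Fin k, ∑ j, ⟪u l d, b j⟫ ^ 2 = 1 := fun l => by
      rw [b.sum_sq_inner_left (u l d), horth.1 l, one_pow]
    simp only [h1, Finset.sum_const, Finset.card_univ, Fintype.card_fin, nsmul_eq_mul, mul_one]
  · -- comparability
    obtain ⟨hzKD, hzO, hπKD⟩ := hmemKD z hz hzR
    have hkk : ∀ (f : Fin k → ℝ) (M : ℝ), (∀ j, |f j| ≤ M) → |∑ j, f j| ≤ k * M := fun f M hf =>
      (Finset.abs_sum_le_sum_abs _ _).trans ((Finset.sum_le_sum fun j _ => hf j).trans (by simp))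
    -- `|Yc z l| ≤ k |Mc| √S`
    have hYc_bound : ∀ l : Fin k, |Yc z l| ≤ k * (|Mc| * Real.sqrt (sqSumGE lam (e z))) := by
      intro l
      rw [hYc_def]
      refine hkk _ _ fun j => ?_
      rw [abs_mul]
      exact mul_le_mul (hMc' l l.isLt j j.isLt _ hπKD) (hcoord_le z j) (abs_nonneg _) (abs_nonneg _)
    -- `‖Y z‖ ≤ C₁ √S`
    have hY_bound : ‖Y z‖ ≤ C₁ * Real.sqrt (sqSumGE lam (e z)) := by
      have h1 : ‖Y z‖ ≤ ∑ l : Fin k, |Yc z l| := by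
        rw [hY_def]
        refine (norm_sum_le _ _).trans (Finset.sum_le_sum fun l _ => ?_)
        rw [norm_smul, hb, (EuclideanSpace.basisFun (Fin n) ℝ).orthonormal.1, mul_one, Real.norm_eq_abs]
      have h2 : ∑ l : Fin k, |Yc z l| ≤ k * (k * (|Mc| * Real.sqrt (sqSumGE lam (e z)))) :=
        (Finset.sum_le_sum fun l _ => hYc_bound l).trans
          (by rw [Finset.sum_const, Finset.card_univ, Fintype.card_fin, nsmul_eq_mul])
      have h3 : (k : ℝ) * (k * (|Mc| * Real.sqrt (sqSumGE lam (e z)))) ≤ C₁ * Real.sqrt (sqSumGE lam (e z)) := by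
        rw [hC₁]
        have := Real.sqrt_nonneg (sqSumGE lam (e z))
        nlinarith [abs_nonneg Mc]
      linarith
    -- `|y_(λ+j)| ≤ k |Mv| ‖Y z‖`
    have hy_bound : ∀ j : Fin k, |e z (idx j)| ≤ k * (|Mv| * ‖Y z‖) := by
      intro j
      rw [hcoord_inv z hzO j]
      refine hkk _ _ fun l => ?_
      rw [abs_mul]
      refine mul_le_mul ((abs_real_inner_le_norm _ _).trans ?_) (hYc_le z l) (abs_nonneg _) (abs_nonneg _)
      rw [(hu_orth _ (hKDsrc hπKD)).1 l, mul_one]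
      exact hMv' j j.isLt _ hπKD
    -- `√S ≤ C₂ ‖Y z‖`
    have hS_bound : Real.sqrt (sqSumGE lam (e z)) ≤ C₂ * ‖Y z‖ := by
      have h1 : sqSumGE lam (e z) ≤ k * (k * (|Mv| * ‖Y z‖)) ^ 2 := by
        rw [hS]
        refine (Finset.sum_le_sum fun j _ => ?_).trans
          (by rw [Finset.sum_const, Finset.card_univ, Fintype.card_fin, nsmul_eq_mul])
        have := hy_bound j
        have h0 : 0 ≤ k * (|Mv| * ‖Y z‖) := by positivity
        nlinarith [abs_nonneg (e z (idx j)), sq_abs (e z (idx j))]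
      have h2 : Real.sqrt (sqSumGE lam (e z)) ≤ Real.sqrt k * (k * (|Mv| * ‖Y z‖)) := by
        rw [← Real.sqrt_sq (by positivity : (0 : ℝ) ≤ k * (|Mv| * ‖Y z‖)), ← Real.sqrt_mul (Nat.cast_nonneg k)]
        exact Real.sqrt_le_sqrt h1
      have hk1 : Real.sqrt k ≤ k := by
        rcases Nat.eq_zero_or_pos k with h0 | h0
        · simp [h0]
        · have : (1 : ℝ) ≤ k := by exact_mod_cast h0
          rw [Real.sqrt_le_left (by linarith)]; nlinarith
      have h3 : Real.sqrt k * (k * (|Mv| * ‖Y z‖)) ≤ C₂ * ‖Y z‖ := by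
        rw [hC₂]
        have : 0 ≤ k * (|Mv| * ‖Y z‖) := by positivity
        nlinarith [norm_nonneg (Y z), abs_nonneg Mv]
      linarith
    refine ⟨hY_bound.trans (mul_le_mul_of_nonneg_right hC₀1 (Real.sqrt_nonneg _)),
      hS_bound.trans (mul_le_mul_of_nonneg_right hC₀2 (norm_nonneg _)), ?_⟩
    -- `‖z - π z‖ ≤ Lψ √S ≤ C₀ ‖Y z‖`
    have hπz : e.symm ((1 / 2 : ℝ) • (e z - milnorModelField lam (e z))) = π z := rfl
    rw [hπz]
    have h1 : ‖z - π z‖ ≤ Lψ * ‖e z - P₀ (e z)‖ := by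
      have hz1 : z = e.symm (e z) := (e.left_inv hz).symm
      have hP₀R : P₀ (e z) ∈ closedBall (0 : EuclideanSpace ℝ (Fin n)) R' := by
        rw [mem_closedBall_zero_iff] at hzR ⊢; exact (hP₀_norm _).trans hzR
      have h := hLψ.dist_le_mul (e z) hzR (P₀ (e z)) hP₀R
      rw [dist_eq_norm, dist_eq_norm] at h
      calc ‖z - π z‖ = ‖e.symm (e z) - e.symm (P₀ (e z))‖ := by rw [hπ_def, ← hz1]
        _ ≤ Lψ * ‖e z - P₀ (e z)‖ := h
    have h2 : ‖e z - P₀ (e z)‖ = Real.sqrt (sqSumGE lam (e z)) := by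
      rw [← hdiff_norm, Real.sqrt_sq (norm_nonneg _)]
    rw [h2] at h1
    calc ‖z - π z‖ ≤ Lψ * Real.sqrt (sqSumGE lam (e z)) := h1
      _ ≤ Lψ * (C₂ * ‖Y z‖) := mul_le_mul_of_nonneg_left hS_bound Lψ.coe_nonneg
      _ = Lψ * C₂ * ‖Y z‖ := by ring
      _ ≤ C₀ * ‖Y z‖ := mul_le_mul_of_nonneg_right hC₀3 (norm_nonneg _)

end Normal

end Literature.Geometry.Riemannian

end
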